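import Summits.BirchSwinnertonDyer.Rank1Residual.X12.CMIrreducible
import Summits.BirchSwinnertonDyer.Rank1Residual.X12.CMNoPrimeTorsion
import Literature.NumberTheory.EllipticCurves.ComplexMultiplicationDeuringReductionSplitProofs
import Literature.NumberTheory.EllipticCurves.IsogenyGeomEndRingProofs
import Literature.NumberTheory.EllipticCurves.IsogenyGeomEndRingQuadraticProofs
import Literature.NumberTheory.EllipticCurves.IsogenyCompProofs
import Literature.NumberTheory.EllipticCurves.ComplexMultiplicationLFunctionIsogenyHoldsProofs
import Literature.NumberTheory.EllipticCurves.BurungaleCastellaSkinnerTian2022.CMPConverse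
import Mathlib.NumberTheory.LSeries.PrimesInAP
import HarnessLib

/-!
# Complex multiplication, the CM field and the X12 class predicates are `ℚ`-ISOGENY INVARIANTS

HONEST FRAMING (cell `b2b-bsdres`, run/shared/lean/b2b/bsd-rank1-residual/, verbatim in every
file): the goal of the cell is to DELETE the COMBINATION-SHAPED residual classes of the
Birch–Swinnerton-Dyer formula for ALL analytic-rank `≤ 1` elliptic curves over `ℚ` — "full BSD
formula for every rank `≤ 1` curve in class `C`" assembled STRICTLY from published theorems — so
that the rank-`≤ 1` remainder becomes exactly the CONSTRUCTION-SHAPED classes, which are TYPED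
(missing-input `Prop`s), NOT attempted. This is not "finishing BSD". Unit `b2b-bsdres-x1b` (X12
prover owner), gen 19. Theorems only (no definition, no named fact); X12 REMAINS
CONSTRUCTION-SHAPED; nothing is booked; no label moves.

## Why this file

Every class-level theorem of the X12 inert-bad core at `p ≥ 11` (`InertCoreManinFree.lean`,
gen 16: the Kolyvagin half of `BSD(E,p)` from published facts ALONE) is stated for the STRONG
(`X₀(N)`-optimal) curve of the isogeny class, and its §3 transports only `BSD(E,p)` itself to the
other members (Cassels). To state the class-level theorems for EVERY curve of the core (successor
file `InertCoreEveryCurve.lean`: the optimal member is SUPPLIED by the Modularity theorem through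
`exists_optimal_modularParametrizationData_of_modularity`, and the one-sided halves are transported
by Cassels' theorem) one needs the class predicate of the unidentified optimal member `W₀ ∼ W`
from that of `W`. This file proves that the cell's predicates are `ℚ`-isogeny invariants:

* §1 `hasCM_of_isIsogenous` / `hasCM_iff_of_isIsogenous` — **(geometric) complex multiplication is
  an isogeny invariant** (elliptic curves over a field of characteristic `0`): transport a CM
  endomorphism `ψ`, `ψ² = [D]`, `D < 0` (`exists_sq_eq_intCast_of_hasCM`, *AEC* III.9) along
  `φ : E → E'` as `ψ' = φ ψ φ̂`, `ψ'² = [(deg φ)² D]`; `ψ'` is no integer since `(deg φ)² D < 0` is no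
  square and `End_{K̄}(E')` has characteristic `0`.
* §2 `cmFieldDiscrOfJ_eq_of_isIsogenous` — **the CM FIELD (the fundamental discriminant `d_K` read
  off the thirteen CM `j`-invariants, `cmFieldDiscrOfJ`) is an isogeny invariant** for CM curves
  over `ℚ`. Odd primes ramified in `K` are detected by the REDUCIBILITY of `E[p]`
  (`irr_iff_not_cmRamified_of_hasCM`, a class property by
  `not_hasIrreducibleModPGaloisRep_of_isIsogenous`), which separates all pairs of the nine fields
  except `ℚ(i)` / `ℚ(√−2)`; those two are separated by the Frobenius trace at a Dirichlet prime
  `ℓ ≡ 5 (mod 8)` (split in `ℚ(i)`: the reduction of the `𝒪_K`-curve is ORDINARY, Deuring /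
  Lang Ch. 13 §4 Thm. 12, tree theorem `Deuring1941_exists_pTorsion_reduction_of_split_holds`, so
  `a_ℓ ≠ 0`; inert in `ℚ(√−2)`: `a_ℓ = 0`, `CMInertTrace` §3), `a_ℓ` being an isogeny invariant
  (Faltings).
* §3 `cmRamified_iff_of_isIsogenous`, `cmSplit_iff_of_isIsogenous`, `cmInert_iff_of_isIsogenous`,
  `classX12_iff_of_isIsogenous` — the cell vocabulary (`Rank1Residual/Predicates`) is constant on
  `ℚ`-isogeny classes (with `analyticRank_eq_of_isIsogenous'` and
  `IsIsogenous.hasGoodReductionAtPrime_iff`).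

Nothing here is specific to the census; no label and no number moves.

References: J. H. Silverman, *AEC* III.4, III.6.1–6.2, III.9 [SilvermanAEC2009]; *Advanced
Topics* II Ex. 2.12(b), App. A §3 [SilvermanAdvancedTopics1994]; S. Lang, *Elliptic Functions*
Ch. 13 §4 Thm. 12 [Lang1987]; G. Faltings (1983) §5 Kor. 2 [Faltings1983Endlichkeit]; B. Mazur,
Invent. Math. 44 (1978) Prop. 6.3 [Mazur1978]; HOME `b2b-bsdres-x1b/X12-ROUTE.md` §23.
-/

set_option autoImplicit false

noncomputable section

open scoped Classical

open WeierstrassCurve Literature.NumberTheory.EllipticCurves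
  Literature.NumberTheory.EllipticCurves.Rank1Residual
  Literature.NumberTheory.EllipticCurves.BurungaleCastellaSkinnerTian2022

namespace Summit.BirchSwinnertonDyer.Rank1Residual.X12

universe u

/-! ## §1 Complex multiplication is an isogeny invariant -/

/-- **CM is a `K`-isogeny invariant** (elliptic curves over a field `K` of characteristic `0`):
if `E ∼ E'` over `K` and `End_{K̄}(E) ≠ ℤ` then `End_{K̄}(E') ≠ ℤ`. Proof: a CM endomorphism `ψ`
with `ψ² = [D]`, `D < 0` (*AEC* Cor. III.6.3 / III.9.4, `exists_sq_eq_intCast_of_hasCM`) goes to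
`ψ' = φ ∘ ψ ∘ φ̂ ∈ End_{K̄}(E')` (`φ̂ ∘ φ = [d]`, `d = deg φ`, *AEC* III.6.1, hence `φ ∘ φ̂ = [d]` as
`φ` is onto), algebraic as a composite of algebraic maps, with `ψ'² = [d² D]`; were `ψ' = [n]`,
`n² = d² D < 0` in the characteristic-`0` ring `End_{K̄}(E')`.
[cite: SilvermanAEC2009, Thm. III.6.1(a), Cor. III.6.3 and Cor. III.9.4] -/
theorem hasCM_of_isIsogenous {K : Type u} [Field K] [CharZero K] {W W' : WeierstrassCurve K}
    [W.IsElliptic] [W'.IsElliptic] (h : IsIsogenous W W') (hCM : W.HasCM) : W'.HasCM := by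
  obtain ⟨φ⟩ := h
  obtain ⟨φd, hφd⟩ := φ.exists_dual_of_isElliptic
  obtain ⟨ψ, hψ, D, hD, hψψ⟩ := W.exists_sq_eq_intCast_of_hasCM hCM
  haveI := charZero_geomEndRing W
  haveI := charZero_geomEndRing W'
  set d : ℤ := (φ.degree : ℤ) with hd_def
  -- `φ ∘ φ̂ = [d]` on `E'(K̄)` (`φ` is onto)
  have hφφd : ∀ Q, φ (φd Q) = d • Q := fun Q ↦ by
    obtain ⟨P, rfl⟩ := φ.surjective Q
    rw [hφd, map_zsmul]
  -- `ψ ≠ 0`, hence algebraic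
  have hψ0 : ψ ≠ 0 := by
    intro h0
    rw [h0, mul_zero] at hψψ
    have h1 : ((D : ℤ) : W.geomEndRing) = 0 :=
      Subtype.ext (by rw [SubringClass.coe_intCast, ← hψψ]; rfl)
    exact hD.ne (Int.cast_eq_zero.mp h1)
  have hψalg : IsAlgebraicOn W W ψ := ((mem_geomEndRing_iff_holds W ψ).mp hψ).resolve_left hψ0
  have hψQ : ∀ P : W.geomPoints, ψ (ψ P) = D • P := fun P ↦ by
    have h := congrArg (fun f : AddMonoid.End W.geomPoints ↦ f P) hψψ
    rw [AddMonoid.End.coe_mul, Function.comp_apply, AddMonoid.End.intCast_apply] at h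
    exact h
  -- the transported endomorphism `ψ' = φ ψ φ̂`
  let g : W'.geomPoints →+ W.geomPoints :=
    AddMonoidHom.comp (show W.geomPoints →+ W.geomPoints from ψ) φd.toAddMonoidHom
  set ψ' : AddMonoid.End W'.geomPoints := AddMonoidHom.comp φ.toAddMonoidHom g with hψ'_def
  have hψ'Q : ∀ Q, ψ' Q = φ (ψ (φd Q)) := fun Q ↦ rfl
  have h1 : IsAlgebraicOn W' W g := hψalg.comp φd.isAlgebraic
  have hψ'alg : IsAlgebraicOn W' W' (fun Q ↦ φ (g Q)) := φ.isAlgebraic.comp h1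
  have hψ'mem : ψ' ∈ W'.geomEndRing :=
    Subring.subset_closure (show IsAlgebraicOn W' W' ψ' from hψ'alg)
  have hψ'ψ' : ∀ Q, ψ' (ψ' Q) = (d * d * D) • Q := fun Q ↦ by
    rw [hψ'Q, hψ'Q, hφd, map_zsmul, hψQ, map_zsmul, map_zsmul, hφφd]
    simp only [smul_smul]
    ring_nf
  refine ⟨ψ', hψ'mem, fun n hn ↦ ?_⟩
  -- `ψ' = [n]` forces `n² = d² D`
  have hnn : ∀ Q : W'.geomPoints, (n * n - d * d * D) • Q = 0 := fun Q ↦ by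
    have h2 : ψ' Q = n • Q := by
      have := congrArg (fun f : AddMonoid.End W'.geomPoints ↦ f Q) hn
      rwa [AddMonoid.End.intCast_apply] at this
    have h3 : ψ' (ψ' Q) = (n * n) • Q := by rw [h2, map_zsmul, h2, smul_smul]
    rw [sub_smul, ← h3, hψ'ψ', sub_self]
  have hcast : (((n * n - d * d * D : ℤ)) : W'.geomEndRing) = 0 := by
    apply Subtype.ext
    rw [SubringClass.coe_intCast]
    ext Q
    rw [AddMonoid.End.intCast_apply, hnn]
    rfl
  have hzero : n * n - d * d * D = 0 := Int.cast_eq_zero.mp hcast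
  have hdpos : 0 < d := by rw [hd_def]; exact_mod_cast φ.degree_pos
  nlinarith [sq_nonneg n, mul_pos (mul_pos hdpos hdpos) (neg_pos.mpr hD)]

/-- **CM is constant on `K`-isogeny classes** (characteristic `0`): `E ∼ E'` ⟹
(`E` has CM ⟺ `E'` has CM). [cite: SilvermanAEC2009, Thm. III.6.1(a) and Cor. III.9.4] -/
theorem hasCM_iff_of_isIsogenous {K : Type u} [Field K] [CharZero K] {W W' : WeierstrassCurve K}
    [W.IsElliptic] [W'.IsElliptic] (h : IsIsogenous W W') : W.HasCM ↔ W'.HasCM :=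
  ⟨hasCM_of_isIsogenous h, hasCM_of_isIsogenous h.symm_of_charZero⟩

/-! ## §2 The CM field is an isogeny invariant -/

section Field

variable {W W' : WeierstrassCurve ℚ} [W.IsElliptic] [W'.IsElliptic]

/-- **Irreducibility of `E[p]` is constant on `ℚ`-isogeny classes** (the contrapositive pair of
`not_hasIrreducibleModPGaloisRep_of_isIsogenous`, both directions by the dual isogeny). [folklore] -/
theorem irr_iff_of_isIsogenous (h : IsIsogenous W W') (p : ℕ) [Fact p.Prime] :
    Irr W p ↔ Irr W' p :=
  ⟨fun hW ↦ by_contra fun hW' ↦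
      not_hasIrreducibleModPGaloisRep_of_isIsogenous h.symm_of_charZero hW' hW,
    fun hW' ↦ by_contra fun hW ↦ not_hasIrreducibleModPGaloisRep_of_isIsogenous h hW hW'⟩

/-- **An odd prime ramifies in the CM field of `E` iff it does so for every `ℚ`-isogenous `E'`**:
at odd `p`, `p ∣ d_K ⟺ E[p]` reducible for a CM curve (`irr_iff_not_cmRamified_of_hasCM`), and
reducibility is a class property. [cite: Mazur1978, Thm 1 (Introduction, pp. 129–130)] -/
theorem cmRamified_iff_of_isIsogenous_of_odd (h : IsIsogenous W W') (hCM : W.HasCM) (p : ℕ)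
    [Fact p.Prime] (hp2 : p ≠ 2) : CMRamified W p ↔ CMRamified W' p := by
  have hCM' : W'.HasCM := hasCM_of_isIsogenous h hCM
  have h1 := irr_iff_not_cmRamified_of_hasCM W p hCM hp2
  have h2 := irr_iff_not_cmRamified_of_hasCM W' p hCM' hp2
  have h3 := irr_iff_of_isIsogenous h p
  tauto

/-- `cmDiscr` (`ComplexMultiplicationCoatesWiles`) and `cmFieldDiscr`
(`ComplexMultiplicationBurungaleFlachDescent`) are the same table. [folklore] -/
theorem cmDiscr_eq_cmFieldDiscr (j : ℚ) : cmDiscr j = cmFieldDiscr j := by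
  simp only [cmDiscr, cmFieldDiscr]

/-- A prime `ℓ ≡ 5 (mod 8)` is odd with `ℓ % 4 = 1`; `−4` is a square and `−8` a non-square
modulo `ℓ` (first and second supplements to quadratic reciprocity). [folklore] -/
theorem isSquare_neg_four_and_not_isSquare_neg_eight {ℓ : ℕ} [Fact ℓ.Prime] (hℓ : ℓ % 8 = 5) :
    IsSquare ((-4 : ℤ) : ZMod ℓ) ∧ ¬ IsSquare ((-8 : ℤ) : ZMod ℓ) := by
  have hℓ2 : ℓ ≠ 2 := by rintro rfl; norm_num at hℓ
  have h2 : (2 : ZMod ℓ) ≠ 0 := by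
    have : ((2 : ℕ) : ZMod ℓ) ≠ 0 := by
      rw [Ne, ZMod.natCast_eq_zero_iff]
      intro h
      exact hℓ2 ((Nat.prime_dvd_prime_iff_eq (Fact.out) Nat.prime_two).mp h)
    simpa using this
  constructor
  · obtain ⟨y, hy⟩ := ZMod.exists_sq_eq_neg_one_iff.mpr (by omega : ℓ % 4 ≠ 3)
    refine ⟨2 * y, ?_⟩
    push_cast
    linear_combination (4 : ZMod ℓ) * hy
  · rintro ⟨x, hx⟩
    have hsq : IsSquare (-2 : ZMod ℓ) := ⟨x * 2⁻¹, by
      push_cast at hx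
      have h4 : (2 : ZMod ℓ) * 2⁻¹ = 1 := mul_inv_cancel₀ h2
      linear_combination (2⁻¹ * 2⁻¹ : ZMod ℓ) * hx + (4 * 2⁻¹ + 2 : ZMod ℓ) * h4⟩
    have := (ZMod.exists_sq_eq_neg_two_iff hℓ2).mp hsq
    omega

/-- **`ℚ(i)` and `ℚ(√−2)` curves are never `ℚ`-isogenous.** For CM curves `E, E'/ℚ` with CM
fields of discriminants `−4` and `−8`: `¬ E ∼ E'`. Pass to the globally minimal `𝒪_K`-models
`E₁ ∼ E`, `E₂ ∼ E'` of the same fields (`CMInertTrace` §4) and a Dirichlet prime `ℓ ≡ 5 (mod 8)`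
of good reduction for both: `ℓ` splits in `ℚ(i)`, so `Ē₁/𝔽_ℓ` has a point of order `ℓ`
(Deuring, Lang Ch. 13 §4 Thm. 12: `Deuring1941_exists_pTorsion_reduction_of_split_holds`) and
`ℓ ∤ a_ℓ(E₁)` (*AEC* V Ex. 5.10(a)); `ℓ` is inert in `ℚ(√−2)`, so `a_ℓ(E₂) = 0`
(`frobeniusTrace_eq_zero_of_not_isSquare_cmFieldDiscr`); but `a_ℓ(E₁) = a_ℓ(E₂)` (Faltings).
[cite: Lang1987, Ch. 13 §4 Thm. 12 (PDF p. 140)] [cite: Faltings1983Endlichkeit, §5 Korollar 2, (i) ⇒ (iv)]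
[cite: SilvermanAEC2009, Ex. V.5.10(a)] -/
theorem not_isIsogenous_of_cmFieldDiscrOfJ_eq_neg_four_of_eq_neg_eight (hCM : W.HasCM)
    (hCM' : W'.HasCM) (hd : cmFieldDiscrOfJ W.j = -4) (hd' : cmFieldDiscrOfJ W'.j = -8) :
    ¬ IsIsogenous W W' := by
  intro h
  have hjW : W.j ∈ cmJInvariants := (hasCM_iff_j_mem_holds W).mp hCM
  have hjW' : W'.j ∈ cmJInvariants := (hasCM_iff_j_mem_holds W').mp hCM'
  obtain ⟨W₁, hE₁, hM₁, h1, hj1, hd1⟩ :=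
    exists_isGloballyMinimal_isIsogenous_maximal_cmFieldDiscr_eq W hjW
  obtain ⟨W₂, hE₂, hM₂, h2, hj2, hd2⟩ :=
    exists_isGloballyMinimal_isIsogenous_maximal_cmFieldDiscr_eq W' hjW'
  rw [hd] at hd1
  rw [hd'] at hd2
  have h12 : IsIsogenous W₁ W₂ := (h1.symm_of_charZero.trans' h).trans' h2
  -- a Dirichlet prime `ℓ ≡ 5 (mod 8)` beyond both minimal discriminants
  obtain ⟨ℓ, hℓn, hℓp, hℓmod⟩ := Nat.forall_exists_prime_gt_and_eq_mod (q := 8) (a := 5)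
    (by decide) (max (minimalDiscriminantInt W₁).natAbs (minimalDiscriminantInt W₂).natAbs)
  haveI : Fact ℓ.Prime := ⟨hℓp⟩
  have hℓ8 : ℓ % 8 = 5 := by
    have h := (ZMod.natCast_eq_natCast_iff' ℓ 5 8).mp (by rw [hℓmod]; rfl)
    norm_num at h
    exact h
  have hℓ2 : ℓ ≠ 2 := by rintro rfl; norm_num at hℓ8
  have hℓZ : Prime (ℓ : ℤ) := Nat.prime_iff_prime_int.mp hℓp
  have hℓpow2 : ∀ k : ℕ, ¬ (ℓ : ℤ) ∣ 2 ^ k := fun k hk ↦ by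
    have h2 : (ℓ : ℤ) ∣ 2 := hℓZ.dvd_of_dvd_pow hk
    have : ℓ ∣ 2 := by exact_mod_cast h2
    exact hℓ2 ((Nat.prime_dvd_prime_iff_eq hℓp Nat.prime_two).mp this)
  simp only [max_lt_iff] at hℓn
  obtain ⟨hΔ₁ℓ, hΔ₂ℓ⟩ := hℓn
  have hΔ₁ : ¬ (ℓ : ℤ) ∣ minimalDiscriminantInt W₁ :=
    natCast_not_dvd_of_natAbs_lt (minimalDiscriminantInt_ne_zero W₁) hΔ₁ℓ
  have hΔ₂ : ¬ (ℓ : ℤ) ∣ minimalDiscriminantInt W₂ :=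
    natCast_not_dvd_of_natAbs_lt (minimalDiscriminantInt_ne_zero W₂) hΔ₂ℓ
  obtain ⟨hsq4, hns8⟩ := isSquare_neg_four_and_not_isSquare_neg_eight hℓ8
  -- `a_ℓ(W₂) = 0` (`ℓ` inert in `ℚ(√−2)`)
  have ha₂ : W₂.frobeniusTrace ℓ = 0 := by
    refine frobeniusTrace_eq_zero_of_not_isSquare_cmFieldDiscr W₂ hj2 ℓ ?_ hΔ₂ (by rwa [hd2])
    rw [hd2]
    intro h16
    exact hℓpow2 4 (by simpa using (dvd_neg.mpr h16 : (ℓ : ℤ) ∣ -(2 * -8)))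
  -- `ℓ ∤ a_ℓ(W₁)` (`ℓ` split in `ℚ(i)`: ordinary reduction)
  have hsplit : IsSquare ((cmDiscr W₁.j : ℤ) : ZMod ℓ) := by
    rwa [cmDiscr_eq_cmFieldDiscr, hd1]
  have hℓ4 : ¬ (ℓ : ℤ) ∣ cmDiscr W₁.j := by
    rw [cmDiscr_eq_cmFieldDiscr, hd1]
    intro h4
    exact hℓpow2 2 (by simpa using (dvd_neg.mpr h4 : (ℓ : ℤ) ∣ -(-4)))
  obtain ⟨P, hP0, hℓP⟩ :=
    Deuring1941_exists_pTorsion_reduction_of_split_holds W₁ hj1 ℓ hℓ2 hΔ₁ hℓ4 hsplit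
  haveI := isElliptic_reductionModPrime W₁ hΔ₁
  have ha₁ : ¬ (ℓ : ℤ) ∣ W₁.frobeniusTrace ℓ := by
    rw [frobeniusTrace_eq_sub_natCard_reductionModPrime]
    obtain ⟨σ, hσ⟩ := WeierstrassCurve.exists_frobenius_absoluteGaloisGroup (ZMod ℓ)
    intro ha
    have ha' : (ℓ : ℤ) ∣ (Nat.card (ZMod ℓ) : ℤ) + 1 -
        Nat.card (reductionModPrime W₁ ℓ).toAffine.Point := by rwa [Nat.card_zmod]
    exact (reductionModPrime W₁ ℓ).forall_nsmul_ne_zero_of_dvd_trace ℓ hσ ha' P hP0 hℓP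
  -- but `a_ℓ(W₁) = a_ℓ(W₂)`
  have hgood₁ : W₁.HasGoodReductionAtPrime ℓ := hasGoodReductionAtPrime_of_not_dvd W₁ ℓ hΔ₁
  have hgood₂ : W₂.HasGoodReductionAtPrime ℓ := hasGoodReductionAtPrime_of_not_dvd W₂ ℓ hΔ₂
  have heq : W₁.frobeniusTrace ℓ = W₂.frobeniusTrace ℓ :=
    frobeniusTrace_eq_of_isIsogenous h12 ℓ hgood₁ hgood₂
  exact ha₁ (by rw [heq, ha₂]; exact dvd_zero _)

/-- Arithmetic of the nine class-number-one discriminants: two of them with the same odd prime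
divisors are equal, or they are `−4` and `−8` in some order. [folklore] -/
theorem cmFieldDiscrOfJ_eq_or_of_forall_odd_prime_dvd_iff {j j' : ℚ} (h0 : cmFieldDiscrOfJ j ≠ 0)
    (h0' : cmFieldDiscrOfJ j' ≠ 0)
    (h : ∀ q : ℕ, q.Prime → q ≠ 2 → ((q : ℤ) ∣ cmFieldDiscrOfJ j ↔ (q : ℤ) ∣ cmFieldDiscrOfJ j')) :
    cmFieldDiscrOfJ j = cmFieldDiscrOfJ j' ∨
      (cmFieldDiscrOfJ j = -4 ∧ cmFieldDiscrOfJ j' = -8) ∨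
      (cmFieldDiscrOfJ j = -8 ∧ cmFieldDiscrOfJ j' = -4) := by
  have h3 := h 3 (by norm_num) (by norm_num)
  have h7 := h 7 (by norm_num) (by norm_num)
  have h11 := h 11 (by norm_num) (by norm_num)
  have h19 := h 19 (by norm_num) (by norm_num)
  have h43 := h 43 (by norm_num) (by norm_num)
  have h67 := h 67 (by norm_num) (by norm_num)
  have h163 := h 163 (by norm_num) (by norm_num)
  have hc := cmFieldDiscrOfJ_cases j
  have hc' := cmFieldDiscrOfJ_cases j'
  generalize cmFieldDiscrOfJ j = d at *
  generalize cmFieldDiscrOfJ j' = d' at *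
  rcases hc with rfl | rfl | rfl | rfl | rfl | rfl | rfl | rfl | rfl | rfl <;>
    rcases hc' with rfl | rfl | rfl | rfl | rfl | rfl | rfl | rfl | rfl | rfl <;>
    omega

/-- **The CM field is a `ℚ`-isogeny invariant.** For `E/ℚ` with CM and `E ∼ E'` over `ℚ`:
`d_K(E) = d_K(E')` — the fundamental discriminant of the CM field read off the `j`-invariant
(`cmFieldDiscrOfJ`). Odd ramified primes agree by `cmRamified_iff_of_isIsogenous_of_odd` (enough
to separate any two of the nine fields except `ℚ(i)`, `ℚ(√−2)`), and `ℚ(i)` / `ℚ(√−2)` curves are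
not isogenous (`not_isIsogenous_of_cmFieldDiscrOfJ_eq_neg_four_of_eq_neg_eight`).
[cite: SilvermanAdvancedTopics1994, Exercise 2.12(b) and App. A §3 (p. 483)]
[cite: Lang1987, Ch. 13 §4 Thm. 12 (PDF p. 140)] [cite: Mazur1978, Thm 1 (Introduction, pp. 129–130)] -/
theorem cmFieldDiscrOfJ_eq_of_isIsogenous (h : IsIsogenous W W') (hCM : W.HasCM) :
    cmFieldDiscrOfJ W.j = cmFieldDiscrOfJ W'.j := by
  have hCM' : W'.HasCM := hasCM_of_isIsogenous h hCM
  have hodd : ∀ q : ℕ, q.Prime → q ≠ 2 →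
      ((q : ℤ) ∣ cmFieldDiscrOfJ W.j ↔ (q : ℤ) ∣ cmFieldDiscrOfJ W'.j) := fun q hq hq2 ↦ by
    haveI : Fact q.Prime := ⟨hq⟩
    exact cmRamified_iff_of_isIsogenous_of_odd h hCM q hq2
  rcases cmFieldDiscrOfJ_eq_or_of_forall_odd_prime_dvd_iff (cmFieldDiscrOfJ_ne_zero_of_hasCM W hCM)
      (cmFieldDiscrOfJ_ne_zero_of_hasCM W' hCM') hodd with he | ⟨h4, h8⟩ | ⟨h8, h4⟩
  · exact he
  · exact absurd h (not_isIsogenous_of_cmFieldDiscrOfJ_eq_neg_four_of_eq_neg_eight hCM hCM' h4 h8)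
  · exact absurd h.symm_of_charZero
      (not_isIsogenous_of_cmFieldDiscrOfJ_eq_neg_four_of_eq_neg_eight hCM' hCM h4 h8)

/-! ## §3 The cell's class vocabulary is constant on `ℚ`-isogeny classes -/

/-- `p` ramified in the CM field: an isogeny invariant (any `p`, CM curves).
[cite: SilvermanAdvancedTopics1994, Exercise 2.12(b) and App. A §3 (p. 483)] -/
theorem cmRamified_iff_of_isIsogenous (h : IsIsogenous W W') (hCM : W.HasCM) (p : ℕ) :
    CMRamified W p ↔ CMRamified W' p := by
  unfold CMRamified
  rw [cmFieldDiscrOfJ_eq_of_isIsogenous h hCM]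

/-- `p` split in the CM field: an isogeny invariant (CM curves).
[cite: SilvermanAdvancedTopics1994, Exercise 2.12(b) and App. A §3 (p. 483)] -/
theorem cmSplit_iff_of_isIsogenous (h : IsIsogenous W W') (hCM : W.HasCM) (p : ℕ) :
    CMSplit W p ↔ CMSplit W' p := by
  unfold CMSplit
  rw [cmFieldDiscrOfJ_eq_of_isIsogenous h hCM]

/-- `p` inert in the CM field: an isogeny invariant (CM curves).
[cite: SilvermanAdvancedTopics1994, Exercise 2.12(b) and App. A §3 (p. 483)] -/
theorem cmInert_iff_of_isIsogenous (h : IsIsogenous W W') (hCM : W.HasCM) (p : ℕ) :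
    CMInert W p ↔ CMInert W' p := by
  unfold CMInert
  rw [cmRamified_iff_of_isIsogenous h hCM p, cmSplit_iff_of_isIsogenous h hCM p]

/-- **Membership in class X12 is a property of the `ℚ`-isogeny class**: CM, the analytic rank
(`analyticRank_eq_of_isIsogenous'`, Faltings), the CM field, and good reduction at `p` (*AEC*
VII.7.2, `IsIsogenous.hasGoodReductionAtPrime_iff`) are isogeny invariants.
[cite: SilvermanAEC2009, Cor. VII.7.2] [cite: Faltings1983Endlichkeit, §5 Korollar 2, (i) ⇒ (iv)] -/
theorem classX12_iff_of_isIsogenous (h : IsIsogenous W W') (p : ℕ) [Fact p.Prime] :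
    ClassX12 W p ↔ ClassX12 W' p := by
  constructor
  · rintro ⟨hCM, hr, hcase⟩
    refine ⟨hasCM_of_isIsogenous h hCM, (analyticRank_eq_of_isIsogenous' h) ▸ hr, ?_⟩
    rcases hcase with h2 | ⟨h3, hs⟩ | hram | hng
    · exact Or.inl h2
    · exact Or.inr (Or.inl ⟨h3, fun hs' ↦ hs ((cmSplit_iff_of_isIsogenous h hCM 3).mpr hs')⟩)
    · exact Or.inr (Or.inr (Or.inl ((cmRamified_iff_of_isIsogenous h hCM p).mp hram)))
    · exact Or.inr (Or.inr (Or.inr fun hg ↦ hng ((h.hasGoodReductionAtPrime_iff p).mpr hg)))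
  · rintro ⟨hCM', hr, hcase⟩
    have hCM : W.HasCM := hasCM_of_isIsogenous h.symm_of_charZero hCM'
    refine ⟨hCM, (analyticRank_eq_of_isIsogenous' h).symm ▸ hr, ?_⟩
    rcases hcase with h2 | ⟨h3, hs⟩ | hram | hng
    · exact Or.inl h2
    · exact Or.inr (Or.inl ⟨h3, fun hs' ↦ hs ((cmSplit_iff_of_isIsogenous h hCM 3).mp hs')⟩)
    · exact Or.inr (Or.inr (Or.inl ((cmRamified_iff_of_isIsogenous h hCM p).mpr hram)))
    · exact Or.inr (Or.inr (Or.inr fun hg ↦ hng ((h.hasGoodReductionAtPrime_iff p).mp hg)))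

end Field

end Summit.BirchSwinnertonDyer.Rank1Residual.X12

end
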